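import Literature.Analysis.FluidPDE.CriticalSpaces
import Literature.Analysis.FunctionSpaces.BMOBesovProofs
import HarnessLib

/-!
# `BMO⁻¹(ℝ³) ⊂ Ḃ^{-1}_{∞,∞}(ℝ³)` for vector fields (proofs)

Sibling proof file of `Literature/Analysis/FluidPDE/CriticalSpaces.lean`, discharging the named
fact `Literature.Analysis.FluidPDE.memHomBesov_neg_one_top_of_memBMOInv` (the last inclusion
`BMO⁻¹ ⊂ Ḃ^{-1}_{∞,∞}` of the chain of critical spaces on `ℝ³`, Koch–Tataru 2001, §1, for
*vector fields* `u₀ : ℝ³ → ℝ³` and their `ℂ³`-valued tempered distributions):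
`Literature.Analysis.FluidPDE.memHomBesov_neg_one_top_of_memBMOInv_holds`. Everything here is
proved; no new definition and no new named fact is introduced.

## Source

H. Koch, D. Tataru, *Well-posedness for the Navier–Stokes equations*, Adv. Math. 157 (2001)
22–35: §1 (the space `BMO⁻¹` of initial data, Theorem 1: `u ∈ BMO⁻¹ ⟺ u = ∑ ∂ᵢ fⁱ`,
`fⁱ ∈ BMO`) and §4, estimate (22): the caloric extension `v = e^{tΔ} u` of `u ∈ BMO⁻¹` satisfies
`|v(x, t)| ≤ c t^{-1/2} ‖u‖_{BMO⁻¹}`, which is the caloric characterisation of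
`‖u‖_{Ḃ^{-1}_{∞,∞}} ≲ ‖u‖_{BMO⁻¹}` (Bahouri–Chemin–Danchin 2011, Thm. 2.34). The *scalar*
Littlewood–Paley form of this inclusion is the named fact
`Literature.Analysis.FunctionSpaces.MemBMOInv.memHomBesov_neg_one_top` of `BMO.lean`, proved in
`Literature/Analysis/FunctionSpaces/BMOBesovProofs.lean`
(`Literature.Analysis.FunctionSpaces.MemBMOInv.memHomBesov_neg_one_top_holds`). The fact
discharged here is its vector form: `Literature.Analysis.FunctionSpaces.MemBMOInvVec u₀` means
that every component `⟪u₀, v⟫` is in `BMO⁻¹`, and the Besov class of the `ℂ³`-valued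
distribution `U` of `u₀` (`Literature.Analysis.FluidPDE.IsDistributionOf u₀ U`) is the
Littlewood–Paley class `Literature.Analysis.FunctionSpaces.MemHomBesov (-1) ∞ ∞ U` of
`LittlewoodPaley.lean`, whose blocks `Δ̇ⱼ`, cut-offs `Ṡⱼ` and `L^∞` norms act on vector-valued
distributions.

## Proof (reduction to components)

For a tempered distribution `U ∈ 𝓢'(E, ℂ^ι)` and a coordinate `i`, the component
`Uᵢ = πᵢ ∘ U ∈ 𝓢'(E, ℂ)` is Mathlib's
`PointwiseConvergenceCLM.postcomp _ (EuclideanSpace.proj i) U`.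

* Mathlib's Fourier multipliers on `𝓢'` act by *precomposition* with a Schwartz-side operator
  (`TemperedDistribution.fourierMultiplierCLM_apply_apply`), so `Δ̇ⱼ` and `Ṡⱼ` commute with
  `πᵢ ∘ ·` definitionally (`lpBlock_postcomp`, `lowFreqCutoff_postcomp`).
* `Ṡⱼ U → 0` in `𝓢'(E, ℂ^ι)` as soon as every `Ṡⱼ Uᵢ → 0` in `𝓢'(E, ℂ)`: the topology of `𝓢'`
  is that of pointwise convergence (`PointwiseConvergenceCLM.tendsto_iff_forall_tendsto`) and
  convergence in `ℂ^ι` is coordinatewise (`tendsto_nhds_zero_of_forall_proj`).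
* `‖U‖_{L^p} ≤ ∑ᵢ ‖Uᵢ‖_{L^p}` for the distributional `L^p` norm
  `Literature.Analysis.FunctionSpaces.eLpNormDistrib` (`eLpNormDistrib_le_sum_proj`): if
  `Uᵢ = [fᵢ]` with `fᵢ ∈ L^p(E; ℂ)` then `U = [∑ᵢ fᵢ eᵢ]` (`eᵢ` the standard basis of `ℂ^ι`,
  `∫ φ (fᵢ eᵢ) = (∫ φ fᵢ) eᵢ = ⟨Uᵢ, φ⟩ eᵢ` and `∑ᵢ ⟨U, φ⟩ᵢ eᵢ = ⟨U, φ⟩`), and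
  `‖∑ᵢ fᵢ eᵢ‖_{L^p} ≤ ∑ᵢ ‖fᵢ‖_{L^p}`. Applied to `Δ̇ⱼ U` and taking the supremum over `j`,
  `‖U‖_{Ḃ^s_{p,∞}} ≤ ∑ᵢ ‖Uᵢ‖_{Ḃ^s_{p,∞}}` (`eHomBesovNorm_top_le_sum_proj`), whence
  `(∀ i, Uᵢ ∈ Ḃ^s_{p,∞}) → U ∈ Ḃ^s_{p,∞}` (`memHomBesov_top_of_forall_proj`).
* If `U` is the distribution of the real field `u₀` (`IsDistributionOf u₀ U`, i.e.
  `⟨U, φ⟩ = ∫ φ • complexify ∘ u₀`), then `Uᵢ` is the distribution of the scalar function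
  `x ↦ u₀ x i` in the sense required by the scalar fact (`IsDistributionOf.proj`, by
  `ContinuousLinearMap.integral_comp_comm`), and `x ↦ u₀ x i = ⟪u₀ x, eᵢ⟫ ∈ BMO⁻¹` by
  `MemBMOInvVec`. The scalar theorem gives `Uᵢ ∈ Ḃ^{-1}_{∞,∞}` for each `i`, and the previous
  point assembles `U ∈ Ḃ^{-1}_{∞,∞}`.

## Main results (all proved)

* `Literature.Analysis.FluidPDE.eLpNormDistrib_le_sum_proj`,
  `Literature.Analysis.FluidPDE.eHomBesovNorm_top_le_sum_proj`,
  `Literature.Analysis.FluidPDE.memHomBesov_top_of_forall_proj`: vector-valued `L^p` /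
  `Ḃ^s_{p,∞}` classes from their components;
* `Literature.Analysis.FluidPDE.IsDistributionOf.proj`: components of the distribution of a field;
* `Literature.Analysis.FluidPDE.memHomBesov_neg_one_top_of_memBMOInv_holds :
  memHomBesov_neg_one_top_of_memBMOInv`.

Not here: the converse bound `max_i ‖Uᵢ‖ ≤ ‖U‖` (not needed), and any statement for `q < ∞`.

## References

* H. Koch, D. Tataru, *Well-posedness for the Navier–Stokes equations*, Adv. Math. 157 (2001),
  22–35, §1, Theorem 1, and §4, (22). [KochTataruAdvMath2001]
* H. Bahouri, J.-Y. Chemin, R. Danchin, *Fourier Analysis and Nonlinear Partial Differential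
  Equations*, Grundlehren 343, Springer (2011), Def. 2.15, Thm. 2.34 ("BCD").
  [BahouriCheminDanchin2011]
-/

noncomputable section

open MeasureTheory TemperedDistribution Filter Topology
open scoped SchwartzMap ENNReal NNReal RealInnerProductSpace

namespace Literature.Analysis.FluidPDE

/-! ## Components of vector-valued tempered distributions -/

section Postcomp

variable {E : Type*} [NormedAddCommGroup E] [InnerProductSpace ℝ E]
variable {F G : Type*} [NormedAddCommGroup F] [NormedSpace ℂ F] [NormedAddCommGroup G]
  [NormedSpace ℂ G]

/-- Post-composition of a tempered distribution `U ∈ 𝓢'(E, F)` with a continuous linear map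
`L : F → G` acts by `⟨L ∘ U, φ⟩ = L ⟨U, φ⟩` (Mathlib's `PointwiseConvergenceCLM.postcomp`;
BCD §1.2, vector-valued distributions). [folklore] -/
theorem postcomp_apply_apply (L : F →L[ℂ] G) (U : 𝓢'(E, F)) (φ : 𝓢(E, ℂ)) :
    PointwiseConvergenceCLM.postcomp 𝓢(E, ℂ) L U φ = L (U φ) := rfl

variable [FiniteDimensional ℝ E] [MeasurableSpace E] [BorelSpace E]

/-- Fourier multipliers on `𝓢'` commute with post-composition by a continuous linear map:
`g(D) (L ∘ U) = L ∘ (g(D) U)`. Definitional, since Mathlib's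
`TemperedDistribution.fourierMultiplierCLM` acts by precomposition with the Schwartz-side
operator `φ ↦ 𝓕 (g · 𝓕⁻¹ φ)` (`fourierMultiplierCLM_apply_apply`; BCD §1.2). [folklore] -/
theorem fourierMultiplierCLM_postcomp (g : E → ℂ) (L : F →L[ℂ] G) (U : 𝓢'(E, F)) :
    fourierMultiplierCLM G g (PointwiseConvergenceCLM.postcomp 𝓢(E, ℂ) L U) =
      PointwiseConvergenceCLM.postcomp 𝓢(E, ℂ) L (fourierMultiplierCLM F g U) := rfl

/-- The dyadic blocks commute with post-composition: `Δ̇ⱼ (L ∘ U) = L ∘ Δ̇ⱼ U`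
(BCD (2.5); definitional, see `fourierMultiplierCLM_postcomp`). [folklore] -/
theorem lpBlock_postcomp (j : ℤ) (L : F →L[ℂ] G) (U : 𝓢'(E, F)) :
    FunctionSpaces.lpBlock j (PointwiseConvergenceCLM.postcomp 𝓢(E, ℂ) L U) =
      PointwiseConvergenceCLM.postcomp 𝓢(E, ℂ) L (FunctionSpaces.lpBlock j U) := rfl

/-- The low-frequency cut-offs commute with post-composition: `Ṡⱼ (L ∘ U) = L ∘ Ṡⱼ U`
(BCD (2.5); definitional, see `fourierMultiplierCLM_postcomp`). [folklore] -/
theorem lowFreqCutoff_postcomp (j : ℤ) (L : F →L[ℂ] G) (U : 𝓢'(E, F)) :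
    FunctionSpaces.lowFreqCutoff j (PointwiseConvergenceCLM.postcomp 𝓢(E, ℂ) L U) =
      PointwiseConvergenceCLM.postcomp 𝓢(E, ℂ) L (FunctionSpaces.lowFreqCutoff j U) := rfl

end Postcomp

section Components

variable {E : Type*} [NormedAddCommGroup E] [InnerProductSpace ℝ E]
variable {ι : Type*} [Fintype ι]

/-- A family of `ℂ^ι`-valued tempered distributions tends to `0` in `𝓢'(E, ℂ^ι)` as soon as each
coordinate family `πᵢ ∘ U` tends to `0` in `𝓢'(E, ℂ)`: the topology of `𝓢'` is pointwise
convergence on test functions (`PointwiseConvergenceCLM.tendsto_iff_forall_tendsto`) and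
convergence in `ℂ^ι` is coordinatewise (BCD §1.2). [folklore] -/
theorem tendsto_nhds_zero_of_forall_proj {α : Type*} {l : Filter α}
    {U : α → 𝓢'(E, EuclideanSpace ℂ ι)}
    (h : ∀ i, Tendsto (fun a => PointwiseConvergenceCLM.postcomp 𝓢(E, ℂ)
      (EuclideanSpace.proj i : EuclideanSpace ℂ ι →L[ℂ] ℂ) (U a)) l (𝓝 0)) :
    Tendsto U l (𝓝 0) := by
  rw [PointwiseConvergenceCLM.tendsto_iff_forall_tendsto]
  intro φ
  have hφ : ∀ i, Tendsto (fun a => (U a φ) i) l (𝓝 0) := fun i =>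
    (PointwiseConvergenceCLM.tendsto_iff_forall_tendsto.1 (h i)) φ
  have hpi : Tendsto (fun a => (WithLp.ofLp (U a φ) : ι → ℂ)) l (𝓝 0) :=
    tendsto_pi_nhds.2 hφ
  have key : Tendsto (fun a => WithLp.toLp 2 (WithLp.ofLp (U a φ))) l
      (𝓝 (WithLp.toLp 2 (0 : ι → ℂ))) :=
    ((PiLp.continuous_toLp 2 (fun _ : ι => ℂ)).tendsto 0).comp hpi
  show Tendsto (fun a => U a φ) l (𝓝 0)
  simpa only [WithLp.toLp_ofLp, WithLp.toLp_zero] using key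

variable [FiniteDimensional ℝ E] [MeasurableSpace E] [BorelSpace E]

/-- **`‖U‖_{L^p} ≤ ∑ᵢ ‖Uᵢ‖_{L^p}`** for the distributional `L^p` norm of a `ℂ^ι`-valued tempered
distribution and its components `Uᵢ = πᵢ ∘ U` (BCD §1.1, `L^p ⊂ 𝓢'` componentwise). If some
`Uᵢ` is not an `L^p` function the right-hand side is `∞`; otherwise `Uᵢ = [fᵢ]`, `fᵢ ∈ L^p`,
and `U = [∑ᵢ fᵢ eᵢ]` with `eᵢ` the standard basis of `ℂ^ι` (`⟨[fᵢ eᵢ], φ⟩ = (∫ φ fᵢ) eᵢ =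
⟨Uᵢ, φ⟩ eᵢ`, `∑ᵢ ⟨U, φ⟩ᵢ eᵢ = ⟨U, φ⟩`), so `‖U‖_{L^p} ≤ ‖∑ᵢ fᵢ eᵢ‖_{L^p} ≤ ∑ᵢ ‖fᵢ‖_{L^p}`.
[folklore] -/
theorem eLpNormDistrib_le_sum_proj (p : ℝ≥0∞) [Fact (1 ≤ p)] (U : 𝓢'(E, EuclideanSpace ℂ ι)) :
    FunctionSpaces.eLpNormDistrib p U ≤
      ∑ i, FunctionSpaces.eLpNormDistrib p (PointwiseConvergenceCLM.postcomp 𝓢(E, ℂ)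
        (EuclideanSpace.proj i : EuclideanSpace ℂ ι →L[ℂ] ℂ) U) := by
  classical
  set Uc : ι → 𝓢'(E, ℂ) := fun i => PointwiseConvergenceCLM.postcomp 𝓢(E, ℂ)
    (EuclideanSpace.proj i : EuclideanSpace ℂ ι →L[ℂ] ℂ) U with hUc
  by_cases h : ∀ i, ∃ f : Lp ℂ p (volume : Measure E), (f : 𝓢'(E, ℂ)) = Uc i
  swap
  · -- some component is not in `L^p`: the bound is `∞`
    obtain ⟨i, hi⟩ := not_forall.1 h
    have htop : FunctionSpaces.eLpNormDistrib p (Uc i) = ∞ :=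
      FunctionSpaces.eLpNormDistrib_of_forall_ne (not_exists.1 hi)
    calc FunctionSpaces.eLpNormDistrib p U ≤ ∞ := le_top
      _ = FunctionSpaces.eLpNormDistrib p (Uc i) := htop.symm
      _ ≤ ∑ j, FunctionSpaces.eLpNormDistrib p (Uc j) :=
          Finset.single_le_sum (f := fun j => FunctionSpaces.eLpNormDistrib p (Uc j))
            (fun _ _ => zero_le) (Finset.mem_univ i)
  choose f hf using h
  -- the standard basis of `ℂ^ι` and the pieces `fᵢ • eᵢ ∈ L^p(E; ℂ^ι)`
  set e : ι → EuclideanSpace ℂ ι := fun i => EuclideanSpace.basisFun ι ℂ i with he_def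
  have he : ∀ i, ‖e i‖ = 1 := fun i => (EuclideanSpace.basisFun ι ℂ).orthonormal.1 i
  have hnorm : ∀ i x, ‖(f i : E → ℂ) x • e i‖ = ‖(f i : E → ℂ) x‖ := fun i x => by
    rw [norm_smul, he i, mul_one]
  have hgi : ∀ i, MemLp (fun x => (f i : E → ℂ) x • e i) p (volume : Measure E) := fun i =>
    MemLp.of_le (Lp.memLp (f i)) ((Lp.memLp (f i)).aestronglyMeasurable.smul_const (e i))
      (Eventually.of_forall fun x => (hnorm i x).le)
  set Gi : ι → Lp (EuclideanSpace ℂ ι) p (volume : Measure E) := fun i => (hgi i).toLp _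
    with hGi_def
  have hGi_norm : ∀ i, ‖Gi i‖ₑ = ‖f i‖ₑ := fun i => by
    rw [hGi_def, Lp.enorm_toLp, Lp.enorm_def]
    exact eLpNorm_congr_norm_ae (Eventually.of_forall fun x => hnorm i x)
  -- `⟨[fᵢ eᵢ], φ⟩ = ⟨U, φ⟩ᵢ eᵢ`
  have hGi_apply : ∀ i (φ : 𝓢(E, ℂ)),
      (Gi i : 𝓢'(E, EuclideanSpace ℂ ι)) φ = (U φ i) • e i := fun i φ => by
    rw [Lp.toTemperedDistribution_apply]
    have hfi := congrArg (fun V : 𝓢'(E, ℂ) => V φ) (hf i)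
    simp only [Lp.toTemperedDistribution_apply, hUc, postcomp_apply_apply, smul_eq_mul] at hfi
    calc ∫ x, φ x • (Gi i : E → EuclideanSpace ℂ ι) x
        = ∫ x, (φ x * (f i : E → ℂ) x) • e i := by
          refine integral_congr_ae ?_
          filter_upwards [(hgi i).coeFn_toLp] with x hx
          rw [hGi_def]
          rw [hx, smul_smul]
      _ = (∫ x, φ x * (f i : E → ℂ) x) • e i := integral_smul_const _ _
      _ = (U φ i) • e i := by rw [hfi]; simp
  -- `[∑ᵢ fᵢ eᵢ] = U`
  have hsumφ : ∀ φ : 𝓢(E, ℂ), ((∑ i, Gi i : Lp (EuclideanSpace ℂ ι) p (volume : Measure E)) :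
      𝓢'(E, EuclideanSpace ℂ ι)) φ = ∑ i, (Gi i : 𝓢'(E, EuclideanSpace ℂ ι)) φ := fun φ =>
    map_sum ((PointwiseConvergenceCLM.evalCLM (RingHom.id ℂ) (EuclideanSpace ℂ ι) φ).comp
      (Lp.toTemperedDistributionCLM (EuclideanSpace ℂ ι) (volume : Measure E) p)) Gi Finset.univ
  have hsum : ((∑ i, Gi i : Lp (EuclideanSpace ℂ ι) p (volume : Measure E)) :
      𝓢'(E, EuclideanSpace ℂ ι)) = U := by
    ext1 φ
    rw [hsumφ φ]
    simp_rw [hGi_apply]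
    simpa only [he_def, EuclideanSpace.basisFun_repr] using
      (EuclideanSpace.basisFun ι ℂ).sum_repr (U φ)
  calc FunctionSpaces.eLpNormDistrib p U
      = FunctionSpaces.eLpNormDistrib p ((∑ i, Gi i : Lp (EuclideanSpace ℂ ι) p
          (volume : Measure E)) : 𝓢'(E, EuclideanSpace ℂ ι)) := by rw [hsum]
    _ ≤ ‖∑ i, Gi i‖ₑ := FunctionSpaces.eLpNormDistrib_coe_le _
    _ ≤ ∑ i, ‖Gi i‖ₑ := enorm_sum_le _ _
    _ = ∑ i, ‖f i‖ₑ := Finset.sum_congr rfl fun i _ => hGi_norm i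
    _ = ∑ i, FunctionSpaces.eLpNormDistrib p (Uc i) := Finset.sum_congr rfl fun i _ => by
        rw [← hf i, FunctionSpaces.eLpNormDistrib_coe]

/-- **`‖U‖_{Ḃ^s_{p,∞}} ≤ ∑ᵢ ‖Uᵢ‖_{Ḃ^s_{p,∞}}`** for a `ℂ^ι`-valued tempered distribution and its
components (BCD Def. 2.15): blockwise `‖Δ̇ⱼ U‖_{L^p} ≤ ∑ᵢ ‖Δ̇ⱼ Uᵢ‖_{L^p}`
(`eLpNormDistrib_le_sum_proj` with `lpBlock_postcomp`), then
`supⱼ ∑ᵢ ≤ ∑ᵢ supⱼ`. [folklore] -/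
theorem eHomBesovNorm_top_le_sum_proj (s : ℝ) (p : ℝ≥0∞) [Fact (1 ≤ p)]
    (U : 𝓢'(E, EuclideanSpace ℂ ι)) :
    FunctionSpaces.eHomBesovNorm s p ∞ U ≤
      ∑ i, FunctionSpaces.eHomBesovNorm s p ∞ (PointwiseConvergenceCLM.postcomp 𝓢(E, ℂ)
        (EuclideanSpace.proj i : EuclideanSpace ℂ ι →L[ℂ] ℂ) U) := by
  simp only [FunctionSpaces.eHomBesovNorm_top]
  refine iSup_le fun j => ?_
  calc (2 : ℝ≥0∞) ^ ((j : ℝ) * s) * FunctionSpaces.eLpNormDistrib p (FunctionSpaces.lpBlock j U)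
      ≤ (2 : ℝ≥0∞) ^ ((j : ℝ) * s) * ∑ i, FunctionSpaces.eLpNormDistrib p
          (PointwiseConvergenceCLM.postcomp 𝓢(E, ℂ)
            (EuclideanSpace.proj i : EuclideanSpace ℂ ι →L[ℂ] ℂ) (FunctionSpaces.lpBlock j U)) := by
        gcongr
        exact eLpNormDistrib_le_sum_proj p _
    _ = ∑ i, (2 : ℝ≥0∞) ^ ((j : ℝ) * s) * FunctionSpaces.eLpNormDistrib p
          (FunctionSpaces.lpBlock j (PointwiseConvergenceCLM.postcomp 𝓢(E, ℂ)
            (EuclideanSpace.proj i : EuclideanSpace ℂ ι →L[ℂ] ℂ) U)) := by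
        rw [Finset.mul_sum]
        rfl
    _ ≤ ∑ i, ⨆ j : ℤ, (2 : ℝ≥0∞) ^ ((j : ℝ) * s) * FunctionSpaces.eLpNormDistrib p
          (FunctionSpaces.lpBlock j (PointwiseConvergenceCLM.postcomp 𝓢(E, ℂ)
            (EuclideanSpace.proj i : EuclideanSpace ℂ ι →L[ℂ] ℂ) U)) :=
        Finset.sum_le_sum fun i _ => le_iSup (fun j : ℤ => (2 : ℝ≥0∞) ^ ((j : ℝ) * s) *
          FunctionSpaces.eLpNormDistrib p (FunctionSpaces.lpBlock j
            (PointwiseConvergenceCLM.postcomp 𝓢(E, ℂ)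
              (EuclideanSpace.proj i : EuclideanSpace ℂ ι →L[ℂ] ℂ) U))) j

/-- **`Ḃ^s_{p,∞}` membership from the components** (BCD Def. 2.15 with Def. 1.26): if every
component `Uᵢ = πᵢ ∘ U` of a `ℂ^ι`-valued tempered distribution lies in `Ḃ^s_{p,∞}` (finite
Littlewood–Paley norm and `Ṡⱼ Uᵢ → 0` as `j → -∞`), then so does `U`
(`eHomBesovNorm_top_le_sum_proj`, `tendsto_nhds_zero_of_forall_proj`, `lowFreqCutoff_postcomp`).
[folklore] -/
theorem memHomBesov_top_of_forall_proj {s : ℝ} {p : ℝ≥0∞} [Fact (1 ≤ p)]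
    {U : 𝓢'(E, EuclideanSpace ℂ ι)}
    (h : ∀ i, FunctionSpaces.MemHomBesov s p ∞ (PointwiseConvergenceCLM.postcomp 𝓢(E, ℂ)
      (EuclideanSpace.proj i : EuclideanSpace ℂ ι →L[ℂ] ℂ) U)) :
    FunctionSpaces.MemHomBesov s p ∞ U := by
  refine ⟨lt_of_le_of_lt (eHomBesovNorm_top_le_sum_proj s p U)
    (ENNReal.sum_lt_top.2 fun i _ => (h i).1), ?_⟩
  exact tendsto_nhds_zero_of_forall_proj fun i => (h i).2

open FunctionSpaces.EuclideanSpace (complexify) in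
/-- **Components of the distribution of a vector field.** If `U ∈ 𝓢'(E, ℂ^ι)` is the tempered
distribution of the real field `u₀ : E → ℝ^ι` (`IsDistributionOf u₀ U`:
`⟨U, φ⟩ = ∫ φ • complexify ∘ u₀` with `φ • complexify ∘ u₀ ∈ L¹`), then the component
`πᵢ ∘ U ∈ 𝓢'(E, ℂ)` is the distribution of the scalar function `x ↦ u₀ x i`:
`φ · (u₀ · i) ∈ L¹` and `⟨πᵢ ∘ U, φ⟩ = ∫ φ (u₀ · i)` (continuous linear maps commute with the
Bochner integral, `ContinuousLinearMap.integral_comp_comm`; BCD §1.2). This is exactly the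
representation hypothesis of `Literature.Analysis.FunctionSpaces.MemBMOInv.memHomBesov_neg_one_top`.
[folklore] -/
theorem IsDistributionOf.proj {u₀ : E → EuclideanSpace ℝ ι} {U : 𝓢'(E, EuclideanSpace ℂ ι)}
    (hU : IsDistributionOf u₀ U) (i : ι) (φ : 𝓢(E, ℂ)) :
    Integrable (fun x => φ x * (u₀ x i : ℂ)) ∧
      PointwiseConvergenceCLM.postcomp 𝓢(E, ℂ)
        (EuclideanSpace.proj i : EuclideanSpace ℂ ι →L[ℂ] ℂ) U φ = ∫ x, φ x * (u₀ x i : ℂ) := by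
  obtain ⟨hint, hUφ⟩ := hU φ
  have hcomp : (fun x => (EuclideanSpace.proj i : EuclideanSpace ℂ ι →L[ℂ] ℂ)
      (φ x • complexify (u₀ x))) = fun x => φ x * (u₀ x i : ℂ) := by
    funext x
    simp
  refine ⟨?_, ?_⟩
  · simpa only [hcomp] using
      (EuclideanSpace.proj i : EuclideanSpace ℂ ι →L[ℂ] ℂ).integrable_comp hint
  · rw [postcomp_apply_apply, hUφ,
      ← (EuclideanSpace.proj i : EuclideanSpace ℂ ι →L[ℂ] ℂ).integral_comp_comm hint, hcomp]

end Components

/-! ## Discharge of the named fact `memHomBesov_neg_one_top_of_memBMOInv` -/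

section Final

/-- **Discharge of `Literature.Analysis.FluidPDE.memHomBesov_neg_one_top_of_memBMOInv`**
(`BMO⁻¹(ℝ³) ⊂ Ḃ^{-1}_{∞,∞}(ℝ³)` for vector fields). Koch–Tataru, Adv. Math. 157 (2001): §1
(the space `BMO⁻¹` of divergences of `BMO` vector fields, Theorem 1) and §4, estimate (22),
`|e^{tΔ}u(x)| ≤ c t^{-1/2} ‖u‖_{BMO⁻¹}` for `u ∈ BMO⁻¹`, i.e. `BMO⁻¹ ↪ Ḃ^{-1}_{∞,∞}` through the
caloric characterisation of `Ḃ^{-1}_{∞,∞}` (BCD Thm. 2.34). If every component `⟪u₀, v⟫` of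
`u₀ : ℝ³ → ℝ³` is in `BMO⁻¹` (`MemBMOInvVec u₀`) and `U ∈ 𝓢'(ℝ³, ℂ³)` is the distribution of `u₀`,
then `U ∈ Ḃ^{-1}_{∞,∞}`: each coordinate `x ↦ u₀ x i = ⟪u₀ x, eᵢ⟫` is in `BMO⁻¹`, its distribution
is the component `πᵢ ∘ U` (`IsDistributionOf.proj`), which lies in `Ḃ^{-1}_{∞,∞}` by the scalar
theorem `Literature.Analysis.FunctionSpaces.MemBMOInv.memHomBesov_neg_one_top_holds`
(`BMOBesovProofs.lean`), and `memHomBesov_top_of_forall_proj` assembles the components.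
[cite: KochTataruAdvMath2001, §1 Theorem 1 and §4 (22)] -/
theorem memHomBesov_neg_one_top_of_memBMOInv_holds : memHomBesov_neg_one_top_of_memBMOInv := by
  intro u₀ hu U hU
  refine memHomBesov_top_of_forall_proj fun i => ?_
  have hui : FunctionSpaces.MemBMOInv (fun x : EuclideanSpace ℝ (Fin 3) => u₀ x i) := by
    have h := hu (EuclideanSpace.basisFun (Fin 3) ℝ i)
    simpa only [EuclideanSpace.inner_basisFun_real] using h
  exact FunctionSpaces.MemBMOInv.memHomBesov_neg_one_top_holds hui _ (hU.proj i)

end Final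

end Literature.Analysis.FluidPDE
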